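import Literature.Claims.NS.ClayVariants
import Literature.Analysis.FluidPDE.ClassicalSolution
import Literature.Analysis.FluidPDE.NSLerayHopf
import HarnessLib

/-!
# Claim skeleton (D-0090 NS-CLAIMS, C38): Thambynayagam, arXiv:1509.08766v3 (2016) — «The Navier–Stokes
# Existence and Smoothness Poser in ℝⁿ»: explicit smooth spatially periodic solutions by an «instantaneous
# sequence» of linear diffusion problems

Typed skeleton of R. K. M. Thambynayagam, *The Navier–Stokes Existence and Smoothness Poser in `ℝⁿ`*,
arXiv:1509.08766 **v3** [math.AP], 26 Mar 2016, 25 pp. (text of record, «POSER»; v1 2015-09-25, v2 2015-11-21; not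
withdrawn; companion arXiv:2205.06179 v4 = Eur. J. Mech. B/Fluids 100 (2023) 12–20 is an exact-solution paper for a
specific triple-periodic family; arXiv:1402.1459 withdrawn 2015 «crucial typographical error»), bib
`Thambynayagam2015`; TeX + PDF + page renders held in `run/shared/lean/pub/ns-claims/sources/Thambynayagam2015/`
(LOCATORS.md by ns-claims-lit-2). UNREFEREED CLAIM under adjudication — NOTHING in this file asserts a step: the
paper's statements are `def … : Prop`; the theorems are kernel relations (composition, Clay link, and two printed
implications that are formal consequences of the set-up). `p. N` = v3 PDF page; `(s.n)` = printed equation numbers;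
`l. N` = v3 TeX lines. The paper has NO theorem environments: the claim is the abstract + §6 (vi); §3 states two
«assertions»; §4 is a construction («prescription»).

## The claimed statement (abstract p. 1, TeX l. 164/178, verbatim)

"We show that for a given smooth solenoidal initial velocity vector field there exist smooth spatially periodic
solutions of pressure and velocity in `ℝⁿ`. An illustrative example in `ℝ³` provides important insights into the
ostensible phenomenon of the blowup time." — §6 (vi) p. 18: "The solution presented in `ℝ³` for velocity and
pressure are smooth and satisfy (2.1)–(2.4)." SETTING (§2 p. 1–2): (2.1) `∂ₜvᵢ + gᵢ = κΔvᵢ − ρ⁻¹∂ᵢp + fᵢ`,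
(2.2) `div v = 0`, (2.3) `gᵢ = Σⱼ vⱼ∂ⱼvᵢ`, (2.4) `v(x,0) = v⁽⁰⁾(x)` solenoidal, `x ∈ ℝⁿ`, `t ≥ 0`, `κ > 0`;
l. 246: "Assuming that `vᵢ(x,t)` and `fᵢ(x,t)` are smooth and separable in `x` and `t`, we seek a solution of the
Navier-Stokes system of equations (2.1)–(2.4) that are spatially periodic in `ℝⁿ`"; §4 sets `f ≡ 0`. Printed scope
hedges: §4 l. 878 p. 11 "The expressions derived for velocity and pressure are smooth and satisfy (2.1)–(2.4) in the
applicable range of the `𝓡e`"; §6 (iii) p. 17–18 "the number of terms required in the finite series is dependent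
on the `𝓡e`"; §4 l. 872 "Nonetheless, the theory holds for all `κ > 0`."

RENDERING: `n = 3` (the Clay dimension; the paper's `n` is general), `ρ = 1`; «spatially periodic» = the tree's
`IsLatticePeriodic` (`ℤ³`-periodic; the paper's examples have period `2` — immaterial, tree
`ClayPeriodScalingBridge`); «smooth solenoidal initial velocity vector field» = `IsDatum` (smooth, divergence free,
periodic); «smooth spatially periodic solutions of pressure and velocity» for `t ≥ 0` = a Clay-(B)-sense solution
(`ClayVariants.clayPeriodic.Solvable κ 0 v⁰`: `v, p ∈ C^∞(ℝ³ × [0,∞))`, (2.1)–(2.4) with `f ≡ 0`, `v(·,t)` periodic).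
So `ClaimedTheorem ↔ ClayVariants.clayPeriodic.Regularity` (`claimedTheorem_iff_clayB`, proved): the abstract's
sentence, read for `n = 3` and all `t ≥ 0`, IS Clay (B); the hedges («applicable range of the `𝓡e`», separability
ansatz) are not part of the abstract's sentence and are recorded at the Steps where they act (Steps 3, 6).
The linear problems of §3–§4 are typed in PDE form (`∂ₜw = κΔw + source` on `ℝ³ × [0,∞)`, periodic, smooth) rather
than by the heat-kernel formulas (3.11)/(4.1)/(4.15)/(4.31)/(4.36) the paper writes for their solutions — equivalent
for bounded smooth periodic data and sources (uniqueness of bounded solutions of the heat equation); the inertial term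
`𝓤 = g − ħ` of (3.9)/(4.8)–(4.10) (`ħ = ∇Δ⁻¹ div g`, the gradient part) is typed by its characterising property
`g = 𝓤 − ∇p`, `div 𝓤 = 0`, `𝓤` periodic, `p` smooth periodic (`IsInertialPart`; the Newtonian-potential integral
printed in (3.5)/(3.9) diverges for periodic `g` — the periodic Helmholtz projection is the intended object).

## Clay delta (reference `Literature.Claims.NS.ClayVariants`)

Nearest Clay statement: (B). Δ1 domain periodic `ℝ³` =; Δ3 force `f ≡ 0` (§4) = ((B) takes `f ≡ 0`); Δ4 data smooth
solenoidal periodic = (8); Δ5/Δ6 solution = smooth periodic `(v,p)` for `t ≥ 0` = (10)(11) (the paper's `p` is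
periodic by (4.39), stronger than printed-(B)); Δ7 every `κ > 0` (l. 872) =. No statement-level delta:
`clay_of_claimed` PROVED. The printed hedges (l. 246 separability; l. 878 «applicable range of the `𝓡e`») would, if
read INTO the claim, make it a restricted statement (Δ4/Δ7) — recorded, not typed into `ClaimedTheorem` (the abstract
and §6 (vi) carry none).

## ORDERED STEP INDEX (dependency order = the order `claim_of_steps` consumes them; ties by print order)

* Step 1 = `Recast` (§3 p. 2–3: (3.1) pressure Poisson equation, (3.6)–(3.9) "we recast the Navier-Stokes equation
  (3.6) as (3.7) `∂ₜvᵢ = κΔvᵢ + 𝓕ᵢ − 𝓤ᵢ`", `𝓤 = g − ħ`): a smooth periodic divergence-free `v` on `[0,∞)` solving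
  the PROJECTED equation `∂ₜv = κΔv − 𝓤`, `g = 𝓤 − ∇p`, is, with that `p`, a Clay-(B)-sense solution. TRUE —
  PROVED (`recast_holds`; it is the definition of the recast).
* Step 2 = `AssertionII` (§3 assertion (ii) p. 3–4, (3.10)–(3.11): "If `𝓤ᵢ⁽⁰⁾(x) ≡ 0` … then, the solution of
  the inhomogeneous diffusion equation (3.11) … is a solution of the Navier-Stokes equation (3.7)"; p. 2: "the
  superscript (0) is used to denote the value of a function at time zero"): for a datum whose inertial term is a
  gradient, the heat flow solves the projected equation for all `t ≥ 0`. On the composition path for the sub-class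
  `𝓤⁽⁰⁾ ≡ 0` (§4 is headed "`𝓤ᵢ⁽⁰⁾(x) ≠ 0`"); verified in print only on the Taylor (2D) and Arnold–Beltrami (3D)
  examples, which are Stokes eigenfunctions.
* Step 3 = `Display45` (§4 p. 5–6, (4.1)–(4.7): "the right hand side of (4.1) may be written as (4.5)
  `… = vᵢ⁽⁰⁾ e^{−ξ₁π²κt}` … (4.6) `vᵢ⁽¹⁾(x,t) = vᵢ⁽⁰⁾(x)𝓣₁(t)`, (4.7) `𝓣₁(t) = e^{−ξ₁π²κt}`, and `ξ₁` is a real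
  positive constant resulting from performing the integrals over the initial velocity vector field `vᵢ⁽⁰⁾(x)`
  comprising circular functions"): the heat flow of the datum is SEPARABLE, `v⁰(x)e^{−ξ₁π²κt}` — i.e. the datum is
  tacitly a Laplace eigenfunction (one wavenumber shell). Typed for the abstract's class `IsDatum` (on the printed
  path: every closed form (4.14)–(4.38), `𝓣ⱼ(t)`, rests on it); `IsShellDatum` records the single-shell class on
  which it holds. Not consumed by the exact-plateau logic of Steps 4–6 (which is separability-free), so a referee may
  table it as a CLASS RESTRICTION (F3) rather than the locator.
* Step 4 = `SequenceExists` (§4 p. 5–10, the «prescription» (4.33)–(4.37): Sequence 1 = heat flow (4.1) with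
  "`𝓤ᵢ = 0` in (3.7)"; Sequence `l+1` = the solution of (3.7) with `𝓤 := 𝓤⁽ˡ⁾` ((4.15), (4.31), (4.36)–(4.37)),
  `𝓤⁽ˡ⁾ = g⁽ˡ⁾ − ħ⁽ˡ⁾` computed from `v⁽ˡ⁾` ((4.8)–(4.13), (4.19)–(4.26), (4.35))): for every datum the sequence of
  LINEAR problems has smooth periodic divergence-free global solutions (`IsSequence`). TRUE, classical (forced heat
  equation with smooth periodic source; periodic Helmholtz decomposition). This sequence is the Picard iteration
  `v⁽ˡ⁺¹⁾ = e^{κtΔ}v⁰ − ∫₀ᵗ e^{κ(t−τ)Δ} ℙ[(v⁽ˡ⁾·∇)v⁽ˡ⁾](τ)dτ`.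
* Step 5 = `PlateauSolves` (§4 p. 5, l. 529–531: "When `𝓤ᵢ⁽ᵏ⁾(x,t) = 𝓤ᵢ⁽ᵏ⁻¹⁾(x,t)` we conclude that the
  manifestation of nonlinearity has ceased and set `𝓤ᵢ(x,t) = 𝓤ᵢ⁽ᵏ⁻¹⁾(x,t)` in (3.7). The solution of (3.7) at
  sequence `(k−1)` satisfies the Navier-Stokes system of equations (2.1)–(2.4)"): an EXACT plateau of the sequence
  yields a solution. TRUE — PROVED from Step 1 (`plateauSolves_of_recast`: at a fixed point the linear problem IS the
  projected equation).
* Step 6 = `PlateauReached` (§4 p. 5 l. 520–523: "for a given solenoidal and spatially periodic initial velocity vector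
  field, the nonlinearity instantaneously spirals from zero to a plateau through a sequence of linear diffusion
  processes in accordance with (3.7)"; p. 5 l. 528–529 "`𝓤ᵢ(x,t)` is manifested through an instantaneous sequence
  `𝓤ᵢ⁽ʲ⁾(x,t)`, `j = 0,1,…` until it plateaus"; p. 10–11 l. 870–872: "We conclude that when `𝓞ᵢ⁽ˡ⁾(x,t)` becomes
  vanishingly small the velocity vector field `vᵢ⁽ˡ⁾(x,t)` at sequence `l` satisfies the Navier-Stokes system of
  equations (2.1)–(2.4). … As the `𝓡e` increases, more and more sequences will be required before `𝓞ᵢ⁽ˡ⁾(x,t)` would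
  become vanishingly small. Nonetheless, the theory holds for all `κ > 0`"): for EVERY datum (with `𝓤⁽⁰⁾ ≢ 0`, the
  case §4 treats) and every `κ > 0`, the sequence PLATEAUS at a finite stage — the reading l. 531 consumes (exact
  equality `𝓤⁽ᵏ⁾ = 𝓤⁽ᵏ⁻¹⁾`). The cell's PRE-REGISTERED LOCATOR (CARD §4, STATUS `PREDICTED C38` 00:09Z): a Picard
  step acting on a trigonometric datum supported on finitely many wavenumbers generates the sum wavenumbers
  `k₁ + k₂`, so the supports strictly grow unless the projected interaction vanishes (the Taylor / Arnold–Beltrami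
  cases of Step 2): no finite plateau for generic data — recorded for the refuter (tree: `TaylorGreenVortex`
  computes the Taylor–Green datum's inertial term), NOT asserted. The «vanishingly small» reading (a LIMIT `l → ∞`)
  is the charitable twin `SequenceConverges` — global-in-time convergence of the Picard iteration for all data and all
  `κ`, which in print rests on nothing (true for small data / large `κ`, i.e. small `𝓡e` — exactly the hedge l. 878).
* HEADLINE = `ClaimedTheorem` (abstract, `n = 3`; `↔` Clay (B)).

COMPOSITION: proved as `claim_of_steps : Step 1 → … → Step 6 → ClaimedTheorem` (case split on `𝓤⁽⁰⁾ ≡ 0`: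
Step 2 + Step 1 on the heat flow of Step 4's Sequence 1; else Steps 4, 6, 5). Step 3 is a hypothesis on the printed
path not consumed by the composition (see its bullet). `claim_of_steps_limit`: the «vanishingly small» reading
composes trivially (`SequenceConverges` contains solvability). The paper's logic composes AS PRINTED once the plateau
(Step 6) is granted; the pre-registered locator is Step 6 (adjudicated by refuter/referee, not here).

WHAT THIS IS NOT: not a claim about NS regularity or blow-up; not a claim about any author beyond the typed locator.
-/

noncomputable section

open Set Function Filter
open scoped ContDiff Laplacian InnerProductSpace RealInnerProductSpace Topology

namespace Literature.Claims.NS.Thambynayagam2015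

open Literature.Analysis.FluidPDE

/-! ### Vocabulary of the paper (§2–§4) over the tree's classical-solution / Clay-spec predicates -/

/-- "a given smooth solenoidal initial velocity vector field … spatially periodic in `ℝⁿ`" (abstract p. 1; (2.4)
p. 2; l. 246; §4 p. 5 "for a given solenoidal and spatially periodic initial velocity vector field"), `n = 3`:
smooth, divergence free, `ℤ³`-periodic. [cite: Thambynayagam2015, §2 (2.4) p.2 and §4 p.5] -/
def IsDatum (v₀ : EuclideanSpace ℝ (Fin 3) → EuclideanSpace ℝ (Fin 3)) : Prop :=
  ContDiff ℝ ∞ v₀ ∧ NSWave0.IsDivFree v₀ ∧ IsLatticePeriodic v₀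

/-- The SINGLE-SHELL sub-class the closed forms of §4 presuppose ((4.5)–(4.7) p. 6: the heat flow of `v⁽⁰⁾` is
`v⁽⁰⁾e^{−ξ₁π²κt}`, "`ξ₁` … resulting from performing the integrals over the initial velocity vector field `vᵢ⁽⁰⁾(x)`
comprising circular functions"): the datum is a Laplace eigenfunction, `Δv⁰ = −ξ₁π² v⁰`. Recorded for the referee
(F3); not part of the abstract's sentence. [cite: Thambynayagam2015, (4.5)–(4.7) p.6] -/
def IsShellDatum (ξ₁ : ℝ) (v₀ : EuclideanSpace ℝ (Fin 3) → EuclideanSpace ℝ (Fin 3)) : Prop :=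
  IsDatum v₀ ∧ 0 < ξ₁ ∧ ∀ x, (Δ v₀) x = -(ξ₁ * Real.pi ^ 2) • v₀ x

/-- The inertial term `𝓤 = g − ħ` of (3.9) p. 3 / (4.8)–(4.10) p. 6 for a slice `w`: `g = (w·∇)w` (2.3), `ħ` its
gradient part (`ħ = ∇Δ⁻¹div g`, the Newtonian-potential formula (3.5)/(3.9)); typed by the characterising
property of the periodic Helmholtz decomposition, with the potential written as a pressure `p` (`ħ = −∇p`, so that
(2.1) reads `∂ₜv = κΔv − 𝓤` ⇔ `∂ₜv + g = κΔv − ∇p`, `ρ = 1`): `g = 𝓤 − ∇p`, `div 𝓤 = 0`, `𝓤` and `p` periodic,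
`p` smooth. [cite: Thambynayagam2015, (3.9) p.3 and (4.8)–(4.10) p.6] -/
def IsInertialPart (w U : EuclideanSpace ℝ (Fin 3) → EuclideanSpace ℝ (Fin 3))
    (p : EuclideanSpace ℝ (Fin 3) → ℝ) : Prop :=
  ContDiff ℝ ∞ p ∧ IsLatticePeriodic p ∧ IsLatticePeriodic U ∧ NSWave0.IsDivFree U ∧
    ∀ x, convect w w x = U x - gradient p x

/-- "`𝓤ᵢ⁽⁰⁾(x) ≡ 0`" (condition (3.10) p. 3 of assertion (ii); p. 2: "the superscript (0) is used to denote the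
value of a function at time zero"): the inertial term OF THE DATUM is a pure gradient.
[cite: Thambynayagam2015, (3.10) p.3] -/
def InertialPartVanishes (v₀ : EuclideanSpace ℝ (Fin 3) → EuclideanSpace ℝ (Fin 3)) : Prop :=
  ∃ p₀ : EuclideanSpace ℝ (Fin 3) → ℝ, IsInertialPart v₀ 0 p₀

/-- A smooth, spatially periodic, divergence-free solution on `ℝ³ × [0,∞)` of the LINEAR diffusion problem
"(3.7) with the inertial term set to `F`": `∂ₜw = κΔw − F`, `w(·,0) = v⁰` (the problems whose heat-kernel solution
formulas are (3.11), (4.1), (4.15), (4.31), (4.36); `f ≡ 0` as in §4). Time derivative = the tree's one-sided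
`timeDerivWithin (Ici 0)`, as in `IsClassicalNSSolutionOn`. [cite: Thambynayagam2015, (3.7) p.3 and (4.1), (4.15), (4.31) pp.5–9] -/
structure IsLinearStep (κ : ℝ) (v₀ : EuclideanSpace ℝ (Fin 3) → EuclideanSpace ℝ (Fin 3))
    (F w : ℝ → EuclideanSpace ℝ (Fin 3) → EuclideanSpace ℝ (Fin 3)) : Prop where
  /-- `w ∈ C^∞(ℝ³ × [0,∞))` -/
  smooth : IsSmoothSpaceTimeOn (Ici 0) w
  /-- `w(·,t)` is `ℤ³`-periodic for `t ≥ 0` -/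
  periodic : ∀ t : ℝ, 0 ≤ t → IsLatticePeriodic (w t)
  /-- `div w(·,t) = 0` for `t ≥ 0` -/
  divFree : ∀ t : ℝ, 0 ≤ t → VectorCalculus.IsDivFree (w t)
  /-- `w(·,0) = v⁰` -/
  initial : w 0 = v₀
  /-- `∂ₜw = κΔw − F` on `ℝ³ × [0,∞)` -/
  eqn : ∀ t : ℝ, 0 ≤ t → ∀ x, timeDerivWithin (Ici 0) w t x = κ • (Δ (w t)) x - F t x

/-- The «instantaneous sequence» of §4 (prescription (4.33)–(4.37) p. 9–10, with (4.1) and (4.8)–(4.13)): level `0`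
carries the datum (`V 0 t = v⁰`, so `U 0 = 𝓤⁽⁰⁾` of (4.8)); Sequence 1 `V 1` = the heat flow ("We begin the
sequencing with no nonlinearity by setting `𝓤ᵢ(x,t) = 0` in (3.7)", (4.1)); Sequence `l+1`, `l ≥ 1`, `V (l+1)` =
the solution of (3.7) with `𝓤 := 𝓤⁽ˡ⁾` ("Substituting for `𝓤ᵢ = 𝓤ᵢ⁽ˡ⁾` in (3.7) and solving the inhomogeneous
diffusion equation", (4.15), (4.31), (4.37): `v⁽ˡ⁺¹⁾ = v⁽ˡ⁾ − 𝓞⁽ˡ⁾`); `U l t` = the inertial term `𝓤⁽ˡ⁾(·,t)` of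
`V l t` with potential `P l t` ((4.35)). [cite: Thambynayagam2015, (4.33)–(4.37) pp.9–10] -/
structure IsSequence (κ : ℝ) (v₀ : EuclideanSpace ℝ (Fin 3) → EuclideanSpace ℝ (Fin 3))
    (V U : ℕ → ℝ → EuclideanSpace ℝ (Fin 3) → EuclideanSpace ℝ (Fin 3))
    (P : ℕ → ℝ → EuclideanSpace ℝ (Fin 3) → ℝ) : Prop where
  /-- level `0` is the datum, constant in time -/
  level0 : ∀ t : ℝ, V 0 t = v₀
  /-- `𝓤⁽ˡ⁾(·,t)` is the inertial term of `v⁽ˡ⁾(·,t)`, potential `P l t` ((4.8)–(4.10), (4.35)) -/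
  inertial : ∀ (l : ℕ) (t : ℝ), 0 ≤ t → IsInertialPart (V l t) (U l t) (P l t)
  /-- the potentials are jointly smooth on `ℝ³ × [0,∞)` (they become the pressure (4.39)) -/
  smoothP : ∀ l : ℕ, IsSmoothSpaceTimeOn (Ici 0) (P l)
  /-- Sequence 1: the heat flow of the datum ((4.1): `𝓤 := 0` in (3.7)) -/
  seq1 : IsLinearStep κ v₀ 0 (V 1)
  /-- Sequence `l+1`, `l ≥ 1`: (3.7) with `𝓤 := 𝓤⁽ˡ⁾` ((4.15), (4.31), (4.37)) -/
  step : ∀ l : ℕ, 1 ≤ l → IsLinearStep κ v₀ (U l) (V (l + 1))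

/-! ### The claimed theorem (abstract p. 1; §6 (vi) p. 18) -/

/-- **HEADLINE (abstract p. 1, `n = 3`)**: "for a given smooth solenoidal initial velocity vector field there exist
smooth spatially periodic solutions of pressure and velocity in `ℝⁿ`" — for every `κ > 0` ((2.1); l. 872 "the theory
holds for all `κ > 0`") and every smooth solenoidal periodic datum, a smooth periodic `(v, p)` on `ℝ³ × [0,∞)`
solving (2.1)–(2.4) with `f ≡ 0` (a Clay-(B)-sense solution, `ClayVariants.clayPeriodic.Solvable`).
[claim: Thambynayagam2015, status: disputed] -/
def ClaimedTheorem : Prop :=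
  ∀ κ : ℝ, 0 < κ → ∀ v₀ : EuclideanSpace ℝ (Fin 3) → EuclideanSpace ℝ (Fin 3), IsDatum v₀ →
    ClayVariants.clayPeriodic.Solvable κ 0 v₀

/-- The headline, so read, IS Clay (B) (`ClayVariants.clayPeriodic.Regularity`, the tree's mirror of the summit
leaf `NavierStokesExistenceSmoothPeriodic`): same data (8), same conclusion (10)(11), `f ≡ 0`, every `ν > 0`.
[cite: FeffermanClay2006, statement (B), CMI offprint p. 2] -/
theorem claimedTheorem_iff_clayB : ClaimedTheorem ↔ ClayVariants.clayPeriodic.Regularity := by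
  constructor
  · intro h ν hν u₀ hs hdiv hper
    exact h ν hν u₀ ⟨hs, hdiv, hper⟩
  · intro h κ hκ v₀ hv₀
    exact h κ hκ v₀ hv₀.1 hv₀.2.1 hv₀.2.2

/-- **Clay link**: the claimed statement implies Clay (B). [cite: FeffermanClay2006, statement (B), CMI offprint p. 2] -/
theorem clay_of_claimed (h : ClaimedTheorem) : ClayVariants.clayPeriodic.Regularity :=
  claimedTheorem_iff_clayB.1 h

/-! ### The paper's steps (no assertion) -/

/-- **Step 1 — the recast (§3 p. 2–3: (3.1), (3.6) ⇒ (3.7) `∂ₜvᵢ = κΔvᵢ + 𝓕ᵢ − 𝓤ᵢ`, (3.9) `𝓤 = g − ħ`)**, in the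
direction the construction uses it: a smooth, periodic, divergence-free `w` on `ℝ³ × [0,∞)` with `w(·,0) = v⁰`
solving the PROJECTED equation `∂ₜw = κΔw − 𝓤`, where `𝓤(·,t)` is the inertial term of `w(·,t)` with a jointly
smooth potential `p` (`(w·∇)w = 𝓤 − ∇p`), gives — with that `p` as pressure — a Clay-(B)-sense solution from `v⁰`
(`f ≡ 0`). (TRUE: PROVED below, `recast_holds`.) [cite: Thambynayagam2015, (3.6)–(3.9) p.3] -/
def Recast : Prop :=
  ∀ (κ : ℝ) (v₀ : EuclideanSpace ℝ (Fin 3) → EuclideanSpace ℝ (Fin 3))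
    (w U : ℝ → EuclideanSpace ℝ (Fin 3) → EuclideanSpace ℝ (Fin 3)) (p : ℝ → EuclideanSpace ℝ (Fin 3) → ℝ),
    IsLinearStep κ v₀ U w → (∀ t : ℝ, 0 ≤ t → IsInertialPart (w t) (U t) (p t)) →
    IsSmoothSpaceTimeOn (Ici 0) p → ClayVariants.clayPeriodic.Solvable κ 0 v₀

/-- **Step 2 — §3 assertion (ii) (p. 3–4, (3.10)–(3.11))**: "If `𝓤ᵢ⁽⁰⁾(x) ≡ 0`; that is (3.10) … then, the
solution of the inhomogeneous diffusion equation (3.11) [the heat flow of `v⁽⁰⁾`, plus the Duhamel term of `𝓕`,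
here `0`] is a solution of the Navier-Stokes equation (3.7)." TYPED (`f ≡ 0`): for a datum whose inertial term is a
gradient, every heat flow `w` of it (`IsLinearStep κ v₀ 0 w`) has, for all `t ≥ 0`, inertial term ZERO with a
jointly smooth potential — i.e. `w` solves the projected equation, hence (Step 1) Navier–Stokes. (Verified in print
on the Taylor and Arnold–Beltrami examples only, both Stokes eigenfunctions, for which `𝓤 ≡ 0` at all times.)
[claim: Thambynayagam2015, status: disputed] -/
def AssertionII : Prop :=
  ∀ (κ : ℝ), 0 < κ → ∀ (v₀ : EuclideanSpace ℝ (Fin 3) → EuclideanSpace ℝ (Fin 3)), IsDatum v₀ →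
    InertialPartVanishes v₀ → ∀ w : ℝ → EuclideanSpace ℝ (Fin 3) → EuclideanSpace ℝ (Fin 3),
      IsLinearStep κ v₀ 0 w →
      ∃ p : ℝ → EuclideanSpace ℝ (Fin 3) → ℝ, IsSmoothSpaceTimeOn (Ici 0) p ∧
        ∀ t : ℝ, 0 ≤ t → IsInertialPart (w t) 0 (p t)

/-- **Step 3 — (4.5)–(4.7) p. 6 (Sequence 1 in closed form)**: "the right hand side of (4.1) may be written as (4.5)
`(2√(πκt))⁻ⁿ∫v⁽⁰⁾(y)e^{−Σ(xₖ−yₖ)²/(4κt)}dy = vᵢ⁽⁰⁾e^{−ξ₁π²κt}`. We have (4.6) `vᵢ⁽¹⁾(x,t) = vᵢ⁽⁰⁾(x)𝓣₁(t)` where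
(4.7) `𝓣₁(t) = e^{−ξ₁π²κt}` and `ξ₁` is a real positive constant resulting from performing the integrals over the
initial velocity vector field `vᵢ⁽⁰⁾(x)` comprising circular functions in `ℝⁿ`." TYPED for the abstract's data class:
every heat flow of every datum is separable with an exponential time factor. (Holds on the single-shell class
`IsShellDatum`; every closed form (4.14)–(4.38) downstream rests on it; NOT consumed by the exact-plateau logic.)
[claim: Thambynayagam2015, status: disputed] -/
def Display45 : Prop :=
  ∀ (κ : ℝ), 0 < κ → ∀ (v₀ : EuclideanSpace ℝ (Fin 3) → EuclideanSpace ℝ (Fin 3)), IsDatum v₀ →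
    ∀ w : ℝ → EuclideanSpace ℝ (Fin 3) → EuclideanSpace ℝ (Fin 3), IsLinearStep κ v₀ 0 w →
      ∃ ξ₁ : ℝ, 0 < ξ₁ ∧ ∀ t : ℝ, 0 ≤ t → ∀ x, w t x = Real.exp (-(ξ₁ * Real.pi ^ 2 * κ * t)) • v₀ x

/-- **Step 4 — the sequence exists (§4 «prescription» (4.33)–(4.37) p. 9–10; (4.1), (4.15), (4.31): "solving the
inhomogeneous diffusion equation, we obtain …")**: for every `κ > 0` and every datum there is an «instantaneous
sequence» `(v⁽ˡ⁾, 𝓤⁽ˡ⁾)` — smooth periodic divergence-free global solutions of the successive LINEAR problems, each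
`𝓤⁽ˡ⁾` the inertial term of `v⁽ˡ⁾`. (TRUE, classical: forced heat equation with smooth periodic source; periodic
Helmholtz decomposition.) [claim: Thambynayagam2015, status: disputed] -/
def SequenceExists : Prop :=
  ∀ (κ : ℝ), 0 < κ → ∀ (v₀ : EuclideanSpace ℝ (Fin 3) → EuclideanSpace ℝ (Fin 3)), IsDatum v₀ →
    ∃ (V U : ℕ → ℝ → EuclideanSpace ℝ (Fin 3) → EuclideanSpace ℝ (Fin 3))
      (P : ℕ → ℝ → EuclideanSpace ℝ (Fin 3) → ℝ), IsSequence κ v₀ V U P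

/-- **Step 5 — an exact plateau solves (§4 p. 5, l. 529–531)**: "When `𝓤ᵢ⁽ᵏ⁾(x,t) = 𝓤ᵢ⁽ᵏ⁻¹⁾(x,t)` we conclude
that the manifestation of nonlinearity has ceased and set `𝓤ᵢ(x,t) = 𝓤ᵢ⁽ᵏ⁻¹⁾(x,t)` in (3.7). The solution of (3.7)
at sequence `(k−1)` [= `v⁽ᵏ⁾`, computed with the source `𝓤⁽ᵏ⁻¹⁾`] satisfies the Navier-Stokes system of equations
(2.1)–(2.4)." (TRUE: at a fixed point the linear problem is the projected equation; PROVED from Step 1,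
`plateauSolves_of_recast`.) [claim: Thambynayagam2015, status: disputed] -/
def PlateauSolves : Prop :=
  ∀ (κ : ℝ) (v₀ : EuclideanSpace ℝ (Fin 3) → EuclideanSpace ℝ (Fin 3))
    (V U : ℕ → ℝ → EuclideanSpace ℝ (Fin 3) → EuclideanSpace ℝ (Fin 3))
    (P : ℕ → ℝ → EuclideanSpace ℝ (Fin 3) → ℝ), IsSequence κ v₀ V U P →
    ∀ k : ℕ, 2 ≤ k → (∀ t : ℝ, 0 ≤ t → U k t = U (k - 1) t) → ClayVariants.clayPeriodic.Solvable κ 0 v₀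

/-- **Step 6 — the plateau is reached (§4 p. 5 l. 520–523, l. 528–529; p. 10–11 l. 870–872) — the cell's
pre-registered locator.** "for a given solenoidal and spatially periodic initial velocity vector field, the
nonlinearity instantaneously spirals from zero to a plateau through a sequence of linear diffusion processes";
"`𝓤ᵢ(x,t)` is manifested through an instantaneous sequence `𝓤ᵢ⁽ʲ⁾(x,t)`, `j = 0,1,…` until it plateaus"; "We
conclude that when `𝓞ᵢ⁽ˡ⁾(x,t)` becomes vanishingly small the velocity vector field `vᵢ⁽ˡ⁾(x,t)` at sequence `l`
satisfies the Navier-Stokes system of equations (2.1)–(2.4). … Nonetheless, the theory holds for all `κ > 0`."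
TYPED in the reading l. 531 consumes (exact equality): for every `κ > 0`, every datum with `𝓤⁽⁰⁾ ≢ 0` (the case of
§4) and every sequence from it, some stage `k ≥ 2` has `𝓤⁽ᵏ⁾ = 𝓤⁽ᵏ⁻¹⁾` on `[0,∞) × ℝ³`. (No finite plateau is
expected for generic trigonometric data — the Picard step generates the sum wavenumbers —; adjudication is the
refuter's. The «vanishingly small»/limit reading is `SequenceConverges`.) [claim: Thambynayagam2015, status: disputed] -/
def PlateauReached : Prop :=
  ∀ (κ : ℝ), 0 < κ → ∀ (v₀ : EuclideanSpace ℝ (Fin 3) → EuclideanSpace ℝ (Fin 3)), IsDatum v₀ →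
    ¬ InertialPartVanishes v₀ →
    ∀ (V U : ℕ → ℝ → EuclideanSpace ℝ (Fin 3) → EuclideanSpace ℝ (Fin 3))
      (P : ℕ → ℝ → EuclideanSpace ℝ (Fin 3) → ℝ), IsSequence κ v₀ V U P →
      ∃ k : ℕ, 2 ≤ k ∧ ∀ t : ℝ, 0 ≤ t → U k t = U (k - 1) t

/-- **Step 6, «vanishingly small» read as a limit (p. 10–11 l. 870–872; §6 (iii) "more and more sequences will be
required")**: the sequence `v⁽ˡ⁾` converges, pointwise on `[0,∞) × ℝ³`, to a smooth periodic `v` which with some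
smooth `p` solves (2.1)–(2.4) (`f ≡ 0`) for all `t ≥ 0` — global-in-time convergence of the Picard iteration for
every datum and every `κ > 0`. The charitable twin of `PlateauReached`; composes by itself
(`claim_of_steps_limit`). [claim: Thambynayagam2015, status: disputed] -/
def SequenceConverges : Prop :=
  ∀ (κ : ℝ), 0 < κ → ∀ (v₀ : EuclideanSpace ℝ (Fin 3) → EuclideanSpace ℝ (Fin 3)), IsDatum v₀ →
    ∀ (V U : ℕ → ℝ → EuclideanSpace ℝ (Fin 3) → EuclideanSpace ℝ (Fin 3))
      (P : ℕ → ℝ → EuclideanSpace ℝ (Fin 3) → ℝ), IsSequence κ v₀ V U P →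
      ∃ (v : ℝ → EuclideanSpace ℝ (Fin 3) → EuclideanSpace ℝ (Fin 3)) (p : ℝ → EuclideanSpace ℝ (Fin 3) → ℝ),
        (∀ t : ℝ, 0 ≤ t → ∀ x, Tendsto (fun l => V l t x) atTop (𝓝 (v t x))) ∧
        IsSmoothOnHalfSpace v ∧ IsSmoothOnHalfSpace p ∧ IsNavierStokesSolution κ 0 v₀ v p ∧
        ∀ t : ℝ, 0 ≤ t → IsLatticePeriodic (v t)

/-! ### Kernel relations -/

/-- **Step 1 is a theorem**: the projected equation plus `(w·∇)w = 𝓤 − ∇p` is the momentum equation (2.1) with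
pressure `p` (`∂ₜw + (w·∇)w = κΔw − 𝓤 + 𝓤 − ∇p`); smoothness, (2.2), (2.4) and periodicity are hypotheses; the
tree's bridge `isNavierStokesSolution_and_smooth_iff` packages it as a Clay-(B)-sense solution.
[cite: Thambynayagam2015, (3.6)–(3.9) p.3] -/
theorem recast_holds : Recast := by
  intro κ v₀ w U p hw hU hp
  have hcl : IsClassicalNSSolutionOn (Ici 0) κ 0 w p := by
    refine ⟨hw.smooth, hp, fun t ht x => ?_, fun t ht => hw.divFree t ht⟩
    have h1 := hw.eqn t ht x
    have h2 := (hU t ht).2.2.2.2 x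
    rw [h1, h2]
    simp only [Pi.zero_apply, add_zero]
    abel
  obtain ⟨hns, hsu, hsp⟩ :=
    (isNavierStokesSolution_and_smooth_iff (ν := κ) (f := 0) (u₀ := v₀) (u := w) (p := p)).2 ⟨hcl, hw.initial⟩
  exact ⟨w, p, hsu, hsp, hns, fun t ht => hw.periodic t ht⟩

/-- **Step 5 follows from Step 1**: if `𝓤⁽ᵏ⁾ = 𝓤⁽ᵏ⁻¹⁾` on `[0,∞)`, then `v⁽ᵏ⁾` — the solution of the linear
problem with source `𝓤⁽ᵏ⁻¹⁾` — solves the projected equation with ITS OWN inertial term `𝓤⁽ᵏ⁾`, so Step 1 applies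
with the potential `P k`. [cite: Thambynayagam2015, §4 p.5 (l.529–531)] -/
theorem plateauSolves_of_recast (h1 : Recast) : PlateauSolves := by
  intro κ v₀ V U P hseq k hk hplat
  obtain ⟨j, rfl⟩ : ∃ j, k = j + 1 := ⟨k - 1, by omega⟩
  have hj : 1 ≤ j := by omega
  have hstep := hseq.step j hj
  -- the linear problem for `V (j+1)` has source `U j = U (j+1)` on `[0,∞)`
  have hstep' : IsLinearStep κ v₀ (U (j + 1)) (V (j + 1)) := by
    refine ⟨hstep.smooth, hstep.periodic, hstep.divFree, hstep.initial, fun t ht x => ?_⟩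
    have hp' : U (j + 1) t = U j t := by simpa using hplat t ht
    rw [hstep.eqn t ht x, hp']
  exact h1 κ v₀ (V (j + 1)) (U (j + 1)) (P (j + 1)) hstep' (fun t ht => hseq.inertial (j + 1) t ht)
    (hseq.smoothP (j + 1))

/-- **Composition — Steps 1–6 give the headline.** Case `𝓤⁽⁰⁾ ≡ 0`: the heat flow `V 1` of Step 4's sequence solves
the projected equation by Step 2, hence Navier–Stokes by Step 1. Case `𝓤⁽⁰⁾ ≢ 0` (§4): Step 4 gives the sequence,
Step 6 a plateau `𝓤⁽ᵏ⁾ = 𝓤⁽ᵏ⁻¹⁾`, Step 5 the solution. Step 3 is on the printed path (every closed form of §4 uses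
it) but is not consumed. Pure logic; nothing asserted. [claim: Thambynayagam2015, status: disputed] -/
theorem claim_of_steps (h1 : Recast) (h2 : AssertionII) (_h3 : Display45) (h4 : SequenceExists)
    (h5 : PlateauSolves) (h6 : PlateauReached) : ClaimedTheorem := by
  intro κ hκ v₀ hv₀
  obtain ⟨V, U, P, hseq⟩ := h4 κ hκ v₀ hv₀
  by_cases h0 : InertialPartVanishes v₀
  · -- §3 (ii): the heat flow is already a solution
    obtain ⟨p, hp, hzero⟩ := h2 κ hκ v₀ hv₀ h0 (V 1) hseq.seq1
    exact h1 κ v₀ (V 1) 0 p hseq.seq1 hzero hp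
  · -- §4: plateau at stage `k`, then Step 5
    obtain ⟨k, hk, hplat⟩ := h6 κ hκ v₀ hv₀ h0 V U P hseq
    exact h5 κ v₀ V U P hseq k hk hplat

/-- **Composition, «vanishingly small» reading**: `SequenceExists ∧ SequenceConverges` already contain a
Clay-(B)-sense solution. [claim: Thambynayagam2015, status: disputed] -/
theorem claim_of_steps_limit (h4 : SequenceExists) (h6 : SequenceConverges) : ClaimedTheorem := by
  intro κ hκ v₀ hv₀
  obtain ⟨V, U, P, hseq⟩ := h4 κ hκ v₀ hv₀
  obtain ⟨v, p, -, hsu, hsp, hns, hper⟩ := h6 κ hκ v₀ hv₀ V U P hseq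
  exact ⟨v, p, hsu, hsp, hns, hper⟩

/-- Steps 1–6 imply Clay (B) (composition + `clay_of_claimed`): if every Step resisted refutation the skeleton would
decide a Clay statement — the lead is told (CARD §3). [cite: FeffermanClay2006, statement (B), CMI offprint p. 2] -/
theorem clayB_of_steps (h1 : Recast) (h2 : AssertionII) (h3 : Display45) (h4 : SequenceExists)
    (h5 : PlateauSolves) (h6 : PlateauReached) : ClayVariants.clayPeriodic.Regularity :=
  clay_of_claimed (claim_of_steps h1 h2 h3 h4 h5 h6)

/-- **Step 5 holds outright** (kernel discharge of the named Prop `PlateauSolves`): Step 1 is a theorem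
(`recast_holds`) and Step 5 follows from Step 1 (`plateauSolves_of_recast`). Nothing else of the paper is used;
the row's locator (`PlateauReached`) and class are untouched. [cite: Thambynayagam2015, §4 p.5 (l.529–531)] -/
theorem plateauSolves_holds : PlateauSolves :=
  plateauSolves_of_recast recast_holds

end Literature.Claims.NS.Thambynayagam2015

end

-- WHAT THIS IS NOT: not a claim about NS regularity or blow-up; not a claim about any author beyond the
-- typed locator.
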